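import Literature.InformationTheory.QuantumCodes.StabilizerDistance
import Literature.InformationTheory.QuantumCodes.CSSParameters
import HarnessLib

/-!
# A check-matrix CSS code as an additive (stabilizer) code: `S̄ = rs H^X × rs H^Z`, `d = min (d^X, d^Z)`,
# and the census predicate `[[n, k, d]]`

For a check-matrix CSS code `C : CSSCode RX RZ (Fin n)` (`CSS.lean`: binary check matrices `H^X`, `H^Z`
with `H^X (H^Z)ᵀ = 0`; `dX`, `dZ`, `k`) this file builds its stabilizer space in the binary symplectic
language of `SymplecticCodes.lean` (Calderbank–Rains–Shor–Sloane 1998) and proves the folklore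
dictionary used by every CSS distance certificate:

* `C.toSympCode = rs H^X × rs H^Z ≤ Ē = 𝔽₂ⁿ × 𝔽₂ⁿ` (CRSS Thm. 9's `ω C₁ + ω̄ C₂⊥`; Nielsen–Chuang eq.
  (10.106): the span of the rows of `[H^X 0; 0 H^Z]`), PROVED self-orthogonal
  (`isSelfOrthogonal_toSympCode`), with normaliser `{(a|b) : H^Z a = 0, H^X b = 0}`
  (`mem_sympDual_toSympCode_iff`; Gottesman 1997 §3.4) and dimension `rank H^X + rank H^Z`
  (`finrank_toSympCode`, `finrank_toSympCode_add_k`, `logicalDim_toSympCode : logicalDim = C.k`);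
* **`minDistance_toSympCode : minDistance C.toSympCode = min C.dX C.dZ`** PROVED (Bravyi et al. 2024:
  "It is known [Steane 1996, Calderbank–Shor 1996] that a CSS code with check matrices `H^X` and `H^Z`
  has distance `d = min(d^X, d^Z)`"; CRSS Thm. 9) — the lemma that lets a certificate `(d^X, d^Z)`
  discharge the stabilizer-code distance `min wt (N(S) ∖ S)`; both sides are the junk value `0` iff
  `k = 0`;
* `isAdditiveCode_toSympCode : IsAdditiveCode C.toSympCode C.k (min C.dX C.dZ)` — an
  `[[n, k, min(d^X,d^Z)]]` additive code in the sense of CRSS Thm. 1 — and `additiveCodeExists_of_cssCode`;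
* `IsCode.isAdditiveCode`: an `[[n, k, d]]` code in the sense of the census predicate `CSSCode.IsCode`
  (`CSSParameters.lean`: exact distance through `cssMinDist`) is an `[[n, k, d]]` additive code in CRSS's
  sense with `minDistance = d`.

## References (locators read on the page)

* [CalderbankEtAl1998] Calderbank–Rains–Shor–Sloane, IEEE Trans. IT 44 (1998) 1369, §2 Thm. 1 (p. 4),
  §5 Thm. 9 (p. 15: CSS, `d = min{dist(C₂∖C₁), dist(C₁⊥∖C₂⊥)}`).
* [BravyiEtAl2024] Bravyi et al., Nature 627 (2024) 778 = arXiv:2308.07915, §4 Lemma 1 and proof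
  (arXiv chunk p0009 L63–117).
* [NielsenChuang2010] Nielsen–Chuang (10th anniv. ed.), §10.5.6 eq. (10.106) (held chunk p0551 L26).
* [Gottesman1997] D. Gottesman, arXiv:quant-ph/9705052, §2.3, §3.4 (chunk p0021 L55-56).
* [TillichZemor2014] Tillich–Zémor, IEEE Trans. IT 60 (2014) 1193 = arXiv:0903.0566, §2, §5 (`cssMinDist`).
-/

namespace Literature.InformationTheory.QuantumCodes

open Matrix

variable {n : ℕ}

/-! ### The stabilizer space of a check-matrix CSS code -/

/-- Each row of a check matrix lies in its row space (the dual code is generated by the rows of `H`,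
i.e. has generator matrix `Hᵀ`). [cite: NielsenChuang2010, §10.4.1 p. 449 (C^⊥ has generator matrix Hᵀ)] -/
theorem row_mem_rowSpace {R Q : Type*} [Fintype R] (H : Matrix R Q (ZMod 2)) (i : R) :
    H i ∈ rowSpace H := by
  rw [show rowSpace H = Submodule.span (ZMod 2) (Set.range H.row) from range_vecMulLinear H]
  exact Submodule.subset_span ⟨i, rfl⟩

namespace CSSCode

variable {RX RZ : Type*} [Fintype RX] [Fintype RZ]

/-- The **stabilizer space** `S̄ = rs H^X × rs H^Z ≤ Ē = 𝔽₂ⁿ × 𝔽₂ⁿ` of a check-matrix CSS code on the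
qubits `Fin n`: the classes `(a|b)` with `a` a combination of `X`-rows and `b` a combination of `Z`-rows
(CRSS Thm. 9: `C = ω C₁ + ω̄ C₂⊥` with `C₁ = rs H^X`, `C₂⊥ = rs H^Z`; Nielsen–Chuang eq. (10.106): the
span of the rows of `[H^X 0; 0 H^Z]`).
[cite: CalderbankEtAl1998, §5 Thm. 9 (printed p. 15)] [cite: NielsenChuang2010, §10.5.6 eq. (10.106) (held chunk p0551 L26)] -/
def toSympCode (C : CSSCode RX RZ (Fin n)) : Submodule (ZMod 2) (SympVec n) :=
  C.rowSpX.prod C.rowSpZ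

/-- Membership: `(a|b) ∈ S̄ ↔ a ∈ rs H^X ∧ b ∈ rs H^Z`. [cite: CalderbankEtAl1998, §5 Thm. 9 (printed p. 15)] -/
theorem mem_toSympCode_iff (C : CSSCode RX RZ (Fin n)) (v : SympVec n) :
    v ∈ C.toSympCode ↔ v.1 ∈ C.rowSpX ∧ v.2 ∈ C.rowSpZ :=
  Submodule.mem_prod

/-- **The normaliser of a CSS code**: `(a|b) ∈ S̄⊥ ↔ H^Z a = 0 ∧ H^X b = 0` ("we determine the vectors
in `N(S)` by evaluating the inner product with the rows of `(A|B)`": `X(a)` must commute with every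
`Z`-row, `Z(b)` with every `X`-row). [cite: Gottesman1997, §3.4 (arXiv chunk p0021 L55-56)] [cite: BravyiEtAl2024, §4 proof of Lemma 1 (arXiv chunk p0009 L109-117)] -/
theorem mem_sympDual_toSympCode_iff (C : CSSCode RX RZ (Fin n)) (w : SympVec n) :
    w ∈ sympDual C.toSympCode ↔ C.HZ *ᵥ w.1 = 0 ∧ C.HX *ᵥ w.2 = 0 := by
  rw [mem_sympDual_iff]
  constructor
  · intro h
    constructor
    · funext j
      have hj := h ((0, C.HZ j) : SympVec n)
        ((C.mem_toSympCode_iff _).2 ⟨Submodule.zero_mem _, row_mem_rowSpace C.HZ j⟩)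
      simp only [sympInner, zero_dotProduct, zero_add] at hj
      rw [Matrix.mulVec, Pi.zero_apply, dotProduct_comm]
      exact hj
    · funext i
      have hi := h ((C.HX i, 0) : SympVec n)
        ((C.mem_toSympCode_iff _).2 ⟨row_mem_rowSpace C.HX i, Submodule.zero_mem _⟩)
      simp only [sympInner, dotProduct_zero, add_zero] at hi
      exact hi
  · rintro ⟨h1, h2⟩ v hv
    obtain ⟨ha, hb⟩ := (C.mem_toSympCode_iff v).1 hv
    rw [sympInner, dotProduct_comm v.1 w.2, dotProduct_eq_zero_of_mem_rowSpace ha h2,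
      dotProduct_eq_zero_of_mem_rowSpace hb h1, add_zero]

/-- **The CSS stabilizer space is self-orthogonal** (the `X`-rows commute with the `Z`-rows because
`H^X (H^Z)ᵀ = 0`; rows of the same type commute trivially). [cite: CalderbankEtAl1998, §5 Thm. 9 (printed p. 15: "C is self-orthogonal")]
[cite: NielsenChuang2010, §10.5.6 eq. (10.106) (held chunk p0551 L26-30: commutativity condition H(C₂^⊥)H(C₁)ᵀ = 0)] -/
theorem isSelfOrthogonal_toSympCode (C : CSSCode RX RZ (Fin n)) : IsSelfOrthogonal C.toSympCode := by
  intro w hw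
  obtain ⟨ha, hb⟩ := (C.mem_toSympCode_iff w).1 hw
  exact (C.mem_sympDual_toSympCode_iff w).2 ⟨C.rowSpX_le_kerZ ha, C.rowSpZ_le_kerX hb⟩

/-- **Dimension of the CSS stabilizer space**: `dim S̄ = rank H^X + rank H^Z`.
[cite: CalderbankEtAl1998, §5 Thm. 9 (printed p. 15: C has dimension dim C₁ + (n − dim C₂))] -/
theorem finrank_toSympCode (C : CSSCode RX RZ (Fin n)) :
    Module.finrank (ZMod 2) C.toSympCode = C.HX.rank + C.HZ.rank := by
  have hr : C.toSympCode = LinearMap.range (C.rowSpX.subtype.prodMap C.rowSpZ.subtype) := by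
    rw [LinearMap.range_prodMap, Submodule.range_subtype, Submodule.range_subtype]; rfl
  have hinj : Function.Injective (C.rowSpX.subtype.prodMap C.rowSpZ.subtype) := by
    rw [← LinearMap.ker_eq_bot, LinearMap.ker_prodMap, LinearMap.ker_eq_bot.2 C.rowSpX.injective_subtype,
      LinearMap.ker_eq_bot.2 C.rowSpZ.injective_subtype, Submodule.prod_bot]
  rw [hr, LinearMap.finrank_range_of_inj hinj, Module.finrank_prod, finrank_rowSpace_eq_rank,
    finrank_rowSpace_eq_rank]

/-- `dim S̄ + k = n` for a CSS code (`k = n − rank H^X − rank H^Z`).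
[cite: BravyiEtAl2024, §4 proof of Lemma 1 ("k = n − rk H^X − rk H^Z")] -/
theorem finrank_toSympCode_add_k (C : CSSCode RX RZ (Fin n)) :
    Module.finrank (ZMod 2) C.toSympCode + C.k = n := by
  have h1 := C.finrank_toSympCode
  have h2 := C.k_eq
  have h3 := C.rank_HX_add_rank_HZ_le
  rw [Fintype.card_fin] at h2 h3
  omega

/-- The additive-code `k` of a CSS code is its CSS `k`: `logicalDim S̄ = n − rank H^X − rank H^Z`.
[cite: BravyiEtAl2024, §4 proof of Lemma 1 ("k = n − rk H^X − rk H^Z")] -/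
theorem logicalDim_toSympCode (C : CSSCode RX RZ (Fin n)) : logicalDim C.toSympCode = C.k := by
  have h := C.finrank_toSympCode_add_k
  unfold logicalDim
  omega

/-- A logical operator of the CSS code exists iff `k > 0` (in which case both an `X`-type and a `Z`-type
one exist). [cite: BravyiEtAl2024, §4 proof of Lemma 1] -/
theorem exists_logical_toSympCode (C : CSSCode RX RZ (Fin n)) (hk : 0 < C.k) :
    ∃ w ∈ sympDual C.toSympCode, w ∉ C.toSympCode := by
  obtain ⟨v, hv, hv'⟩ := (C.dX_pos_iff).1 (C.dX_pos_of_k_pos hk)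
  exact ⟨(v, 0), (C.mem_sympDual_toSympCode_iff _).2 ⟨hv, Matrix.mulVec_zero _⟩,
    fun h => hv' ((C.mem_toSympCode_iff _).1 h).1⟩

/-- **`d = min (d^X, d^Z)` for CSS codes** — the stabilizer-code distance of a check-matrix CSS code is
the smaller of its `X`- and `Z`-distances ("It is known that a CSS code with check matrices `H^X` and
`H^Z` has distance `d = min(d^X, d^Z)`"; CRSS Thm. 9: `d = min{dist(C₂ ∖ C₁), dist(C₁⊥ ∖ C₂⊥)}`).
Proof: an `X`-logical `v` gives the logical `(v|0)` of the same weight (`≤`); conversely a mixed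
logical `(a|b) ∉ S̄` has `a ∉ rs H^X` or `b ∉ rs H^Z` while `H^Z a = 0`, `H^X b = 0`, so its weight
dominates `wt a ≥ d^X` or `wt b ≥ d^Z` (`≥`). Both sides are the junk value `0` when `k = 0`.
[cite: BravyiEtAl2024, §4 proof of Lemma 1 (arXiv chunk p0009 L109-111: "d = min(d^X, d^Z)")] [cite: CalderbankEtAl1998, §5 Thm. 9 (printed p. 15)] -/
theorem minDistance_toSympCode (C : CSSCode RX RZ (Fin n)) :
    minDistance C.toSympCode = min C.dX C.dZ := by
  rcases Nat.eq_zero_or_pos C.k with hk | hk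
  · -- no logical operators: both sides are the junk value 0
    have hX : C.dX = 0 := (C.k_eq_zero_iff_dX_eq_zero).1 hk
    have hZ : C.dZ = 0 := (C.dX_eq_zero_iff_dZ_eq_zero).1 hX
    have hX' : C.kerZ = C.rowSpX := (C.dX_eq_zero_iff).1 hX
    have hZ' : C.kerX = C.rowSpZ := (C.swap.dX_eq_zero_iff).1 hZ
    rw [hX, hZ, Nat.min_self, minDistance_eq_zero_iff]
    intro w hw
    obtain ⟨h1, h2⟩ := (C.mem_sympDual_toSympCode_iff w).1 hw
    exact (C.mem_toSympCode_iff w).2 ⟨hX' ▸ (h1 : w.1 ∈ C.kerZ), hZ' ▸ (h2 : w.2 ∈ C.kerX)⟩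
  · refine le_antisymm (le_min ?_ ?_) (le_minDistance (C.exists_logical_toSympCode hk) ?_)
    · obtain ⟨v, hv, hv', hvd⟩ := C.exists_hammingNorm_eq_dX ((C.dX_pos_iff).1 (C.dX_pos_of_k_pos hk))
      rw [← hvd, ← sympWeight_mk_zero_snd]
      exact minDistance_le_sympWeight ((C.mem_sympDual_toSympCode_iff _).2 ⟨hv, Matrix.mulVec_zero _⟩)
        fun h => hv' ((C.mem_toSympCode_iff _).1 h).1
    · obtain ⟨v, hv, hv', hvd⟩ := C.exists_hammingNorm_eq_dZ ((C.dZ_pos_iff).1 (C.dZ_pos_of_k_pos hk))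
      rw [← hvd, ← sympWeight_mk_zero_fst]
      exact minDistance_le_sympWeight ((C.mem_sympDual_toSympCode_iff _).2 ⟨Matrix.mulVec_zero _, hv⟩)
        fun h => hv' ((C.mem_toSympCode_iff _).1 h).2
    · intro w hw hw'
      obtain ⟨h1, h2⟩ := (C.mem_sympDual_toSympCode_iff w).1 hw
      rw [C.mem_toSympCode_iff, not_and_or] at hw'
      rcases hw' with ha | hb
      · exact (min_le_left _ _).trans ((C.dX_le_hammingNorm h1 ha).trans (hammingNorm_fst_le_sympWeight w))
      · exact (min_le_right _ _).trans ((C.dZ_le_hammingNorm h2 hb).trans (hammingNorm_snd_le_sympWeight w))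

/-- The CSS code has the minimum-distance property `HasMinDist S̄ (min d^X d^Z)` of CRSS Thm. 1.
[cite: CalderbankEtAl1998, §2 Thm. 1 (printed p. 4) and §5 Thm. 9 (printed p. 15)] -/
theorem hasMinDist_toSympCode (C : CSSCode RX RZ (Fin n)) : HasMinDist C.toSympCode (min C.dX C.dZ) :=
  C.minDistance_toSympCode ▸ hasMinDist_minDistance _

/-- **A check-matrix CSS code is an `[[n, k, min(d^X, d^Z)]]` additive code** in the sense of CRSS
Thm. 1 (`IsAdditiveCode`: self-orthogonal, `dim S̄ + k = n`, no vector of weight `< min(d^X,d^Z)` in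
`S̄⊥ ∖ S̄`; for `k = 0` the distance entry is the junk value `0`, which the `[[n,0,d]]` clause accepts).
[cite: CalderbankEtAl1998, §2 Thm. 1 (printed p. 4) and §5 Thm. 9 (printed p. 15)]
[cite: BravyiEtAl2024, §4 Lemma 1 (parameters [[n,k,d]], d = min(d^X,d^Z))] -/
theorem isAdditiveCode_toSympCode (C : CSSCode RX RZ (Fin n)) :
    IsAdditiveCode C.toSympCode C.k (min C.dX C.dZ) := by
  refine ⟨C.isSelfOrthogonal_toSympCode, C.finrank_toSympCode_add_k, C.hasMinDist_toSympCode, ?_⟩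
  intro hk v _ _
  rw [(C.k_eq_zero_iff_dX_eq_zero).1 hk, Nat.zero_min]
  exact Nat.zero_le _

/-- Existence form: the parameters `[[n, k, min(d^X, d^Z)]]` are realised (`AdditiveCodeExists`).
[cite: CalderbankEtAl1998, §2 (printed p. 4: "parameters [[n,k,d]]")] -/
theorem additiveCodeExists_of_cssCode (C : CSSCode RX RZ (Fin n)) :
    AdditiveCodeExists n C.k (min C.dX C.dZ) :=
  ⟨C.toSympCode, C.isAdditiveCode_toSympCode⟩

/-! ### `[[n, k, d]]` check-matrix CSS codes are `[[n, k, d]]` additive codes -/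

/-- An `[[n, k, d]]` check-matrix CSS code on `Fin n` is an `[[n, k, d]]` additive code in CRSS's sense
with minimum distance exactly `d`. [cite: CalderbankEtAl1998, §2 Thm. 1 (printed p. 4) and §5 Thm. 9 (printed p. 15)] -/
theorem IsCode.isAdditiveCode {C : CSSCode RX RZ (Fin n)} {m k d : ℕ} (h : C.IsCode m k d) :
    IsAdditiveCode C.toSympCode k d ∧ minDistance C.toSympCode = d := by
  obtain ⟨-, rfl, hmin⟩ := (C.isCode_iff (h.2.1.symm ▸ h.k_pos)).1 h
  exact ⟨hmin ▸ C.isAdditiveCode_toSympCode, hmin ▸ C.minDistance_toSympCode⟩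

end CSSCode

end Literature.InformationTheory.QuantumCodes
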